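import Mathlib
import Literature.NumberTheory.Automorphic.AutomorphicRepsGL
import Literature.NumberTheory.Automorphic.LeviConstantTermIdeal
import Literature.NumberTheory.Automorphic.CuspidalRepDataOfCuspFormInfChar
import Literature.NumberTheory.Automorphic.AutomorphicRepDataSplitCenter
import Literature.NumberTheory.Automorphic.AutomorphicFormsSpan
import Literature.NumberTheory.Automorphic.AutomorphicRepsGLPeterssonAdmissible
import Summits.Langlands.Langlands.Theorems.IrreducibilityBySelfDualityHeckeEigenvalueFieldStubB1
import Summits.Langlands.Langlands.Theorems.IrreducibilityBySelfDualityHeckeEigenvalueFieldStubB2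
import HarnessLib

/-!
# Crux `HeckeEigenvalueField` (stmt-Langlands-13632), line `BaireSketch` — stub (B): a countable
# family of finite-codimension ideals of `Z(𝔤𝔩_n(K_∞))` killing forms of regular algebraic representations

Supports file for the crux `Summit.Langlands.Langlands.Theses.IrreducibilityBySelfDuality.HeckeEigenvalueField`
(= `Literature.NumberTheory.Automorphic.Clozel1990_heckeEigenvalueField`; Clozel 1990 Thm. 3.13 in
Hecke-eigenvalue form).  Registered stub `stub_B` of the line (the `Z(𝔤)`-side of statement (S4),
countability of the unramified Hecke eigensystem germs), assembled from the landed stubs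
`stub_B1` (`…StubB1.lean`: for a regular algebraic `π = W/W'` the finitely many generators `g i` of
`Z(𝔤𝔩_n(K_∞))` act on `W` modulo `W'` by scalars `c i` drawn from a COUNTABLE set — the infinity type
pins the central character through the Harish-Chandra homomorphism) and `stub_B2` (`…StubB2.lean`:
generalised-eigenvector extraction for commuting endomorphisms on a finite-dimensional stable subspace).

* `stub_B` — there is a countable family `𝒥` of ideals of finite codimension of
  `Z(𝔤) = centerU (archGroupGL n K)` such that every form `φ ∈ W ∖ W'` of a regular algebraic automorphic
  representation `π = W/W'` of `GL_n(𝔸_K)` can be replaced by a form `ψ ∈ W ∖ W'` with the same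
  finite-adelic invariances and annihilated (through the word action) by some `J ∈ 𝒥`.  The ideals are
  the relation ideals `relIdeal g (Q(c i)^m)`, `Q(c) = (X - c)(X - c̄) ∈ ℝ[X]`, of finite codimension by
  `finite_quot_relIdeal`; `ψ = a φ` is the generalised eigenvector of `stub_B2` for the enveloping action
  of the `g i` on the finite-dimensional `Z(𝔤)`-orbit of `φ` in `W` (`exists_generalised_eigenvector`),
  which keeps finite-adelic invariances (`rightTranslation_adjoin_apply`, central words commute with
  finite-adelic translations) and is killed by the central words of the ideal
  (`applyFree_eq_zero_of_iterate`, `applyFree_eq_zero_of_mem_relIdeal`).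

(Resubmission, by the continuation lead, of the content of p109477 — bounced only by a gate restart.)

References: Harish-Chandra, *Automorphic forms on semisimple Lie groups*, LNM 62 (1968) [HarishChandra1968];
A. Borel, H. Jacquet, *Automorphic forms and automorphic representations*, Corvallis I (1979) §4 [BorelJacquet1979].
-/

set_option linter.dupNamespace false -- project-wide: `Summit.Langlands.Langlands` is the mandated namespace

noncomputable section

open scoped Pointwise Classical Polynomial
open Filter NumberField NumberField.mixedEmbedding IsDedekindDomain UniversalEnvelopingAlgebra Polynomial
open Literature.NumberTheory.Automorphic

namespace Summit.Langlands.Langlands.Theorems.HeckeEigenvalueField.Baire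

variable {n : ℕ} {K : Type} [Field K] [NumberField K]

/-! ## Assembly of stub B from B1 and B2 -/

/-- The real quadratic `Q(c) = X² - 2 Re(c) X + |c|²` is monic. [folklore] -/
theorem monic_quadratic (c : ℂ) : (X ^ 2 - C (2 * c.re) * X + C (Complex.normSq c) : ℝ[X]).Monic := by
  have h : (X ^ 2 - C (2 * c.re) * X + C (Complex.normSq c) : ℝ[X]) =
      X ^ 2 + (C (-(2 * c.re)) * X + C (Complex.normSq c)) := by
    simp only [map_neg, neg_mul]
    ring
  rw [h]
  exact (monic_X_pow 2).add_of_left ((degree_linear_le).trans_lt (by rw [degree_X_pow]; norm_num))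

section PointwiseHelpers

variable {A V : Type*} [Ring A] [Algebra ℝ A] [AddCommGroup V] [Module ℂ V]

/-- Pointwise `map_mul` for algebra maps into endomorphisms. [folklore] -/
theorem algHom_mul_apply (f : A →ₐ[ℝ] Module.End ℂ V) (x y : A) (v : V) :
    f (x * y) v = f x (f y v) := by
  rw [map_mul]
  rfl

/-- Pointwise powers: `f (u ^ m) v = (f u)^[m] v`. [folklore] -/
theorem algHom_pow_apply (f : A →ₐ[ℝ] Module.End ℂ V) (u : A) (m : ℕ) (v : V) :
    f (u ^ m) v = (fun w => f u w)^[m] v := by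
  induction m generalizing v with
  | zero => rw [pow_zero, map_one, Function.iterate_zero_apply]; rfl
  | succ m ih => rw [pow_succ, algHom_mul_apply, ih, Function.iterate_succ_apply]

/-- Pointwise action of the real quadratic `Q(c) = X² - 2 Re(c) X + |c|²` evaluated at `z`:
`f(Q(c)(z)) v = (f z - c̄)(f z - c) v`. [folklore] -/
theorem algHom_aeval_quadratic_apply (f : A →ₐ[ℝ] Module.End ℂ V) (z : A) (c : ℂ) (v : V) :
    f (aeval z (X ^ 2 - C (2 * c.re) * X + C (Complex.normSq c))) v =
      (fun w => f z w - (starRingEnd ℂ) c • w) ((fun w => f z w - c • w) v) := by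
  have h1 : ((2 * c.re : ℝ) : ℂ) = (starRingEnd ℂ) c + c := by
    rw [add_comm, Complex.add_conj]
  have h2 : ((Complex.normSq c : ℝ) : ℂ) = (starRingEnd ℂ) c * c :=
    Complex.normSq_eq_conj_mul_self
  have hsmul : ∀ (r : ℝ) (w : V), f (algebraMap ℝ A r) w = (r : ℂ) • w := by
    intro r w
    rw [AlgHom.commutes, Algebra.algebraMap_eq_smul_one, LinearMap.smul_apply, Module.End.one_apply,
      Complex.coe_smul]
  simp only [map_add, map_sub, aeval_X_pow, aeval_mul, aeval_C, aeval_X, LinearMap.add_apply,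
    LinearMap.sub_apply, algHom_pow_apply, Function.iterate_succ_apply, Function.iterate_zero_apply,
    algHom_mul_apply, hsmul, h1, h2, map_sub, LinearMap.map_smul, smul_sub, add_smul, mul_smul]
  abel

/-- The two linear factors `w ↦ f z w - a • w`, `w ↦ f z w - b • w` commute. [folklore] -/
theorem commute_sub_smul (T : Module.End ℂ V) (a b : ℂ) :
    Function.Commute (fun w => T w - a • w) (fun w => T w - b • w) := by
  intro w
  simp only [map_sub, LinearMap.map_smul, smul_sub, smul_smul, mul_comm a b]
  abel

/-- `w ↦ T w - a • w` fixes `0`, hence so do its iterates. [folklore] -/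
theorem iterate_sub_smul_zero (T : Module.End ℂ V) (a : ℂ) (m : ℕ) :
    (fun w => T w - a • w)^[m] 0 = 0 :=
  Function.iterate_fixed (by rw [map_zero, smul_zero, sub_zero]) m

end PointwiseHelpers

section Core

variable {hcpt : isCompact_glFiniteIntegralLevel n K} (π : AutomorphicRepData (AutomorphyDatum.gl n K hcpt))

/-- **The Lie action of `π` on `W`, re-typed on `archGroupGL n K`**, together with the fact that
its enveloping action is the word action on functions (`coe_lift_lieRepW_freeToEnveloping`).
[folklore] -/
theorem exists_lieAction_archGroupGL :
    ∃ E : UniversalEnvelopingAlgebra ℝ (archGroupGL n K).lie →ₐ[ℝ] Module.End ℂ π.W,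
      ∀ (p : FreeAlgebra ℝ (archGroupGL n K).lie) (w : π.W),
        ((E (freeToEnveloping (archGroupGL n K) p) w : π.W) : ((AdelicGroupData.gl n K).Adelic → ℂ)) =
          applyFree (AutomorphyDatum.gl n K hcpt).ofArch p w :=
  ⟨lift ℝ π.lieRepW, fun p w => π.coe_lift_lieRepW_freeToEnveloping p w⟩

variable {π} {E : UniversalEnvelopingAlgebra ℝ (archGroupGL n K).lie →ₐ[ℝ] Module.End ℂ π.W}
  (hρ : ∀ (p : FreeAlgebra ℝ (archGroupGL n K).lie) (w : π.W),
    ((E (freeToEnveloping (archGroupGL n K) p) w : π.W) : ((AdelicGroupData.gl n K).Adelic → ℂ)) =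
      applyFree (AutomorphyDatum.gl n K hcpt).ofArch p w)

include hρ

/-- Central elements of `Z(𝔤)` act on `W`, on functions, through central words. [folklore] -/
theorem coe_lift_center {z : UniversalEnvelopingAlgebra ℝ (archGroupGL n K).lie} (hz : z ∈ centerU (archGroupGL n K)) :
    ∃ (p : FreeAlgebra ℝ (archGroupGL n K).lie), freeToEnveloping (archGroupGL n K) p = z ∧
      IsCentralWord p ∧
      ∀ w : π.W, ((E z w : π.W) : ((AdelicGroupData.gl n K).Adelic → ℂ)) = applyFree (AutomorphyDatum.gl n K hcpt).ofArch p w := by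
  obtain ⟨p, hp⟩ := freeToEnveloping_surjective (archGroupGL n K) z
  have hpc : IsCentralWord p := by
    change freeToEnveloping _ p ∈ centerU (archGroupGL n K)
    rw [hp]
    exact hz
  refine ⟨p, hp, hpc, fun w => ?_⟩
  rw [← hp]
  exact hρ p w

/-- **The `Z(𝔤)`-orbit of `φ ∈ W` inside `W` is finite-dimensional** (`Z(𝔤)`-finiteness of the
automorphic form `φ`, read through the word action). [folklore] -/
theorem finiteDimensional_span_lift_center (φW : π.W) :
    FiniteDimensional ℂ (Submodule.span ℂ (Set.range fun z : centerU (archGroupGL n K) =>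
      E (z : UniversalEnvelopingAlgebra ℝ (archGroupGL n K).lie) φW)) := by
  have haut : IsAutomorphicForm (AutomorphyDatum.gl n K hcpt) (φW : ((AdelicGroupData.gl n K).Adelic → ℂ)) :=
    isAutomorphicForm_of_mem_automorphicForms_gl (π.stable.le_automorphicForms φW.2)
  haveI : FiniteDimensional ℂ (zOrbitSpan (AutomorphyDatum.gl n K hcpt).ofArch (φW : ((AdelicGroupData.gl n K).Adelic → ℂ))) :=
    haut.zFinite
  obtain ⟨F, hF⟩ : ∃ F : Submodule ℂ π.W, F = Submodule.span ℂ
      (Set.range fun z : centerU (archGroupGL n K) => E (z : UniversalEnvelopingAlgebra ℝ (archGroupGL n K).lie) φW) := ⟨_, rfl⟩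
  rw [← hF]
  have hle : F.map π.W.subtype ≤ zOrbitSpan (AutomorphyDatum.gl n K hcpt).ofArch (φW : ((AdelicGroupData.gl n K).Adelic → ℂ)) := by
    rw [hF, Submodule.map_span_le]
    rintro _ ⟨z, rfl⟩
    obtain ⟨p, -, hpc, hp⟩ := coe_lift_center hρ z.2
    refine Submodule.subset_span ⟨p, hpc, ?_⟩
    rw [Submodule.coe_subtype]
    exact hp φW
  haveI : FiniteDimensional ℂ (F.map π.W.subtype) := Submodule.finiteDimensional_of_le hle
  exact LinearEquiv.finiteDimensional
    (Submodule.equivMapOfInjective π.W.subtype π.W.injective_subtype F).symm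

variable {ι₀ : Type} (gU : ι₀ → UniversalEnvelopingAlgebra ℝ (archGroupGL n K).lie) (hgU : ∀ i, gU i ∈ centerU (archGroupGL n K))

include hgU

omit hρ in
/-- The enveloping actions of central elements commute (pointwise). [folklore] -/
theorem lift_center_comm (i j : ι₀) (v : π.W) :
    E (gU i) (E (gU j) v) = E (gU j) (E (gU i) v) := by
  have h : gU i * gU j = gU j * gU i := (Subalgebra.mem_center_iff.1 (hgU i) (gU j)).symm
  rw [← algHom_mul_apply, ← algHom_mul_apply, h]

set_option maxHeartbeats 800000 in
/-- **The generalised eigenvector** (stub B2 applied to the enveloping action of the central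
elements `gU i` on `W`, the subspace `W'` and the `Z(𝔤)`-orbit of `φ`). [folklore] -/
theorem exists_generalised_eigenvector [Fintype ι₀] (c : ι₀ → ℂ)
    (hc : ∀ (i : ι₀) (p : FreeAlgebra ℝ (archGroupGL n K).lie),
      freeToEnveloping (archGroupGL n K) p = gU i →
        ∀ w ∈ π.W, applyFree (AutomorphyDatum.gl n K hcpt).ofArch p w - c i • w ∈ π.W')
    (φW : π.W) (hφW' : (φW : ((AdelicGroupData.gl n K).Adelic → ℂ)) ∉ π.W') :
    ∃ a ∈ Algebra.adjoin ℂ (Set.range fun i => E (gU i)),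
      ((a φW : π.W) : ((AdelicGroupData.gl n K).Adelic → ℂ)) ∉ π.W' ∧
        ∃ m : ℕ, ∀ i, (fun v : π.W => E (gU i) v - c i • v)^[m] (a φW) = 0 := by
  classical
  -- central words for the `gU i`, and the action read on functions
  have hword : ∀ i, ∃ (p : FreeAlgebra ℝ (archGroupGL n K).lie),
      freeToEnveloping (archGroupGL n K) p = gU i ∧ ∀ w : π.W,
        ((E (gU i) w : π.W) : ((AdelicGroupData.gl n K).Adelic → ℂ)) = applyFree (AutomorphyDatum.gl n K hcpt).ofArch p w := by
    intro i
    obtain ⟨p, hp, -, hpw⟩ := coe_lift_center hρ (hgU i)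
    exact ⟨p, hp, hpw⟩
  choose pw hpw hEcoe using hword
  -- `P = W'` inside `W`
  obtain ⟨P, hP⟩ : ∃ P : Submodule ℂ π.W, P = π.W'.comap π.W.subtype := ⟨_, rfl⟩
  have hPmem : ∀ w : π.W, w ∈ P ↔ (w : ((AdelicGroupData.gl n K).Adelic → ℂ)) ∈ π.W' := fun w => by rw [hP]; rfl
  have hPE : ∀ i, ∀ v ∈ P, E (gU i) v ∈ P := by
    intro i v hv
    rw [hPmem] at hv ⊢
    rw [hEcoe i v]
    exact π.stable'.applyFree_mem (pw i) hv
  -- `F` = the `Z(𝔤)`-orbit of `φ` inside `W`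
  obtain ⟨F, hF⟩ : ∃ F : Submodule ℂ π.W, F = Submodule.span ℂ
      (Set.range fun z : centerU (archGroupGL n K) => E (z : UniversalEnvelopingAlgebra ℝ (archGroupGL n K).lie) φW) := ⟨_, rfl⟩
  have hφF : φW ∈ F := by
    rw [hF]
    refine Submodule.subset_span ⟨1, ?_⟩
    show E (((1 : centerU (archGroupGL n K)) : UniversalEnvelopingAlgebra ℝ (archGroupGL n K).lie)) φW = φW
    rw [OneMemClass.coe_one, map_one, Module.End.one_apply]
  have hFE : ∀ i, ∀ v ∈ F, E (gU i) v ∈ F := by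
    intro i v hv
    rw [hF] at hv ⊢
    refine Submodule.span_induction ?_ ?_ ?_ ?_ hv
    · rintro _ ⟨z, rfl⟩
      refine Submodule.subset_span ⟨⟨gU i, hgU i⟩ * z, ?_⟩
      show E (((⟨gU i, hgU i⟩ * z : centerU (archGroupGL n K)) : UniversalEnvelopingAlgebra ℝ (archGroupGL n K).lie)) φW = E (gU i) (E (z : UniversalEnvelopingAlgebra ℝ (archGroupGL n K).lie) φW)
      rw [Subalgebra.coe_mul, algHom_mul_apply]
    · rw [map_zero]
      exact Submodule.zero_mem _
    · intro x y _ _ hx hy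
      rw [map_add]
      exact Submodule.add_mem _ hx hy
    · intro a x _ hx
      rw [map_smul]
      exact Submodule.smul_mem _ a hx
  haveI : FiniteDimensional ℂ F := by
    rw [hF]
    exact finiteDimensional_span_lift_center hρ φW
  have hcF : ∀ i, ∀ v ∈ F, E (gU i) v - c i • v ∈ P := by
    intro i v _
    rw [hPmem, Submodule.coe_sub, Submodule.coe_smul, hEcoe i v]
    exact hc i (pw i) (hpw i) v v.2
  have hB2 := stub_B2 (fun i => E (gU i)) (lift_center_comm gU hgU) c P F hPE hFE hcF hφF
    (show φW ∉ P from fun h => hφW' ((hPmem φW).1 h))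
  obtain ⟨a, ha, haP, m, hm⟩ := hB2
  exact ⟨a, ha, fun h => haP ((hPmem _).2 h), m, hm⟩

set_option maxHeartbeats 400000 in
/-- **Finite-adelic invariances are kept** by everything in the algebra generated by the
enveloping action of central elements (central words commute with finite-adelic right
translations, `applyFree_rightTranslation_of_mem_finiteAdelic`). [folklore] -/
theorem rightTranslation_adjoin_apply {a : Module.End ℂ π.W}
    (ha : a ∈ Algebra.adjoin ℂ (Set.range fun i => E (gU i))) {u : (AdelicGroupData.gl n K).Adelic}
    (hu : u ∈ (AutomorphyDatum.gl n K hcpt).finiteAdelic) (w : π.W)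
    (hw : rightTranslation (AdelicGroupData.gl n K) u (w : ((AdelicGroupData.gl n K).Adelic → ℂ)) = w) :
    rightTranslation (AdelicGroupData.gl n K) u ((a w : π.W) : ((AdelicGroupData.gl n K).Adelic → ℂ)) = a w := by
  let T : Submodule ℂ π.W :=
    LinearMap.eqLocus ((rightTranslation (AdelicGroupData.gl n K) u).comp π.W.subtype) π.W.subtype
  have hT : ∀ w : π.W, w ∈ T ↔ rightTranslation (AdelicGroupData.gl n K) u (w : ((AdelicGroupData.gl n K).Adelic → ℂ)) = w :=
    fun w => Iff.rfl
  have hTE : ∀ i, ∀ w ∈ T, E (gU i) w ∈ T := by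
    intro i w hw
    obtain ⟨p, -, -, hp⟩ := coe_lift_center hρ (hgU i)
    rw [hT] at hw ⊢
    rw [hp w, ← applyFree_rightTranslation_of_mem_finiteAdelic p hu, hw]
  have hTa : ∀ b ∈ Algebra.adjoin ℂ (Set.range fun i => E (gU i)), ∀ w ∈ T, b w ∈ T := by
    intro b hb
    refine Algebra.adjoin_induction (p := fun b _ => ∀ w ∈ T, b w ∈ T) ?_ ?_ ?_ ?_ hb
    · rintro _ ⟨i, rfl⟩ w hw
      exact hTE i w hw
    · intro r w hw
      rw [Module.algebraMap_end_apply]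
      exact T.smul_mem r hw
    · intro x y _ _ hx hy w hw
      rw [LinearMap.add_apply]
      exact T.add_mem (hx w hw) (hy w hw)
    · intro x y _ _ hx hy w hw
      rw [Module.End.mul_apply]
      exact hx _ (hy w hw)
  exact (hT _).1 (hTa a ha w ((hT w).2 hw))

omit hgU

set_option maxHeartbeats 400000 in
/-- **Central words in the ideal of relations kill the generalised eigenvector**: if
`(gU i - c i)^[m]` kills `w`, then every word whose image in `U(𝔤)` is a multiple of
`Q(c i)(gU i)^m`, `Q(c) = (X - c)(X - c̄)`, kills `w` (pointwise polynomial calculus,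
`algHom_aeval_quadratic_apply`). [folklore] -/
theorem applyFree_eq_zero_of_iterate (c : ι₀ → ℂ) (m : ℕ) (w : π.W) (i : ι₀)
    (hm : (fun v : π.W => E (gU i) v - c i • v)^[m] w = 0)
    (q : FreeAlgebra ℝ (archGroupGL n K).lie) (r : UniversalEnvelopingAlgebra ℝ (archGroupGL n K).lie)
    (hqr : freeToEnveloping (archGroupGL n K) q =
      r * aeval (gU i) ((X ^ 2 - C (2 * (c i).re) * X + C (Complex.normSq (c i))) ^ m)) :
    applyFree (AutomorphyDatum.gl n K hcpt).ofArch q (w : ((AdelicGroupData.gl n K).Adelic → ℂ)) = 0 := by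
  rw [← hρ q w, hqr, algHom_mul_apply, map_pow, algHom_pow_apply]
  have hstep : (fun v : π.W => E (aeval (gU i)
        (X ^ 2 - C (2 * (c i).re) * X + C (Complex.normSq (c i)))) v) =
      (fun v : π.W => E (gU i) v - (starRingEnd ℂ) (c i) • v) ∘
        (fun v : π.W => E (gU i) v - c i • v) := by
    funext v
    rw [Function.comp_apply, algHom_aeval_quadratic_apply]
  rw [hstep, (commute_sub_smul (E (gU i)) ((starRingEnd ℂ) (c i)) (c i)).comp_iterate,
    Function.comp_apply, hm, iterate_sub_smul_zero, map_zero]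
  rfl

end Core

set_option maxHeartbeats 800000 in
/-- **(B), from B1 and B2.** A countable family `𝒥` of ideals of finite codimension of
`Z(𝔤𝔩_n(K_∞))` such that every form of a regular algebraic automorphic representation `π = W / W'`
outside `W'` can be replaced, keeping its finite-adelic invariances, by a form of `W ∖ W'`
annihilated by a member of `𝒥`: the ideals are the `relIdeal g (Q(c i)^m)` for the generators `g`
and countably many scalar vectors `c` of stub B1 (`Q(c) = (X - c)(X - c̄) ∈ ℝ[X]`), of finite
codimension by `finite_quot_relIdeal`; the form is the generalised eigenvector of stub B2 for the
enveloping action of the `g i` on `W` (`exists_generalised_eigenvector`), which keeps the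
invariances (`rightTranslation_adjoin_apply`) and is killed by the central words of the ideal
(`applyFree_eq_zero_of_mem_relIdeal`, `applyFree_eq_zero_of_iterate`). [folklore] -/
theorem stub_B (hcpt : isCompact_glFiniteIntegralLevel n K) :
    ∃ 𝒥 : Set (Ideal (centerU (archGroupGL n K))), 𝒥.Countable ∧
      (∀ J ∈ 𝒥, FiniteDimensional ℝ (centerU (archGroupGL n K) ⧸ J)) ∧
      ∀ (π : AutomorphicRepData (AutomorphyDatum.gl n K hcpt)), π.IsRegularAlgebraic →
        ∀ φ ∈ π.W, φ ∉ π.W' →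
          ∃ ψ ∈ π.W, ψ ∉ π.W' ∧
            (∀ u ∈ (AutomorphyDatum.gl n K hcpt).finiteAdelic,
              rightTranslation (AdelicGroupData.gl n K) u φ = φ →
              rightTranslation (AdelicGroupData.gl n K) u ψ = ψ) ∧
            ∃ J ∈ 𝒥, ∀ (p : FreeAlgebra ℝ (archGroupGL n K).lie) (hp : IsCentralWord p),
              (⟨freeToEnveloping (archGroupGL n K) p, hp⟩ : centerU (archGroupGL n K)) ∈ J →
                applyFree (AutomorphyDatum.gl n K hcpt).ofArch p ψ = 0 := by
  classical
  obtain ⟨ι₀, _, g, C₀, hgen, hC₀, hK⟩ := stub_B1 (n := n) (K := K) hcpt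
  obtain ⟨Q, hQ⟩ : ∃ Q : ℂ → ℝ[X], Q = fun c => X ^ 2 - C (2 * c.re) * X + C (Complex.normSq c) :=
    ⟨_, rfl⟩
  refine ⟨(fun cm : (ι₀ → ℂ) × ℕ => relIdeal (archGroupGL n K) g (fun i => Q (cm.1 i) ^ cm.2)) ''
      (C₀ ×ˢ Set.univ), (hC₀.prod Set.countable_univ).image _, ?_, ?_⟩
  · rintro J ⟨⟨c, m⟩, -, rfl⟩
    exact finite_quot_relIdeal hgen fun i => by rw [hQ]; exact (monic_quadratic (c i)).pow m
  · intro π hπ φ hφW hφW'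
    have hKπ := hK π hπ
    obtain ⟨c, hcC, hc⟩ := hKπ
    obtain ⟨E, hρ⟩ := exists_lieAction_archGroupGL π
    have hev := exists_generalised_eigenvector hρ (fun i => ((g i : centerU (archGroupGL n K)) : UniversalEnvelopingAlgebra ℝ (archGroupGL n K).lie))
      (fun i => (g i).2) c hc ⟨φ, hφW⟩ hφW'
    obtain ⟨a, ha, haP, m, hm⟩ := hev
    refine ⟨((a ⟨φ, hφW⟩ : π.W) : ((AdelicGroupData.gl n K).Adelic → ℂ)), (a ⟨φ, hφW⟩).2, haP,
      fun u hu hφu => rightTranslation_adjoin_apply hρ _ (fun i => (g i).2) ha hu ⟨φ, hφW⟩ hφu, ?_⟩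
    refine ⟨relIdeal (archGroupGL n K) g (fun i => Q (c i) ^ m), ⟨(c, m), ⟨hcC, Set.mem_univ _⟩, rfl⟩,
      fun p hp hpJ => ?_⟩
    exact applyFree_eq_zero_of_mem_relIdeal (ι := (AutomorphyDatum.gl n K hcpt).ofArch)
      (π.isArchSmooth_of_mem_W (a ⟨φ, hφW⟩).2)
      (fun i q r hqr => applyFree_eq_zero_of_iterate hρ
        (fun i => ((g i : centerU (archGroupGL n K)) : UniversalEnvelopingAlgebra ℝ (archGroupGL n K).lie)) c m _ i (hm i) q r
        (by simp only [hQ] at hqr; exact hqr)) hp hpJ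


end Summit.Langlands.Langlands.Theorems.HeckeEigenvalueField.Baire

end
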